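import Summits.HodgeConjecture.HodgeConjecture.Theorems.F0LD1CharThetaSpaceLeOfIrreducible
import Literature.NumberTheory.Automorphic.Liu2021.ThetaLiftFromLineRealises
import Literature.NumberTheory.Automorphic.HilbertRepOrthogonalDecomposition
import HarnessLib

-- As in the lineage (★ `F0LD1MeetsOfRealises`): statements over the theta-kernel datum elaborate to very large types; elaborate sequentially.
set_option Elab.async false

/-!
# Crux `HLiu418`, line LD2 — letter (B6) `Liu2021.ThetaLiftFromLineRealises` IS A MULTIPLICITY-ONE STATEMENT: the realisation row follows from
# (I′) irreducibility of the `(a, ξ)`-theta span and MULTIPLICITY ONE of that span in `L²([U(H)])`, by the unitary Schur dichotomy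

Cell hodgecm-mathlib (D-0151), FLOOR 0; crux item `HLiu418` = stmt-HodgeConjecture-24832; LD lines (sockets `stub_S1_facts` ∕ `stub_S1b_facts` of
`Cruxes/HLiu418/Lines/F0_AlbCm.lean`), shared printed letter stub `stub_letter_B6` of both LD leaves (`Lines/F0_P6LD_StubS1FactsThetaRoad.lean`,
`Lines/F0_P6LD_StubS1bFactsOrganRoad.lean`).  Seat LD2-p01 (g4), COST-CENSUS deliverable «ROAD M» for the books (LD2-plan (g3) option (i), 2026-09-02).
THEOREMS ONLY (no `def`, no instance, no notation, no named fact, no `sorry`); `--supports stmt-HodgeConjecture-24832`.  HC_CM is proved only modulo the 7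
printed citations (2 remaining: hLiu418 = stmt-HodgeConjecture-24832, h413 = stmt-HodgeConjecture-24833) until rung 0 closes; NOTHING printed is discharged
here and NO row is booked by this file: it prices the letter (B6) = [Liu2021, Cor. B.6 (1) second clause] = [Wu2013, Thm. 5.1] against the tree.

THE POINT.  In the tree's reading, (B6) `ThetaLiftFromLineRealises L N H e₁ dV hdV hdV0 ιA μA μ hμ a ξ` says: every discrete automorphic `P ⊆ L²([U(H)], μA)`
whose orthogonal projection does not kill every `(a, ξ)`-theta class `[Θ̃_Ψ(ξ) ∘ ιA]` lies inside the CLOSED SPAN `Q` of those classes.  Under the letters'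
scaled frame and a pinned transport `ιA`, `Q` is a closed `R`-invariant subspace (★ `F0LD1CharThetaSpaceLeOfIrreducible.exists_closedSubrep_thetaSpan`), and the
sibling row (I′) `ThetaLiftFromLineIrreducible` — a THEOREM of the tree over the CM curve frames (LD leaves, `stub_letter_thetaIrr`, via the theta dichotomy
bricks) — says `Q = 0` or `Q` is topologically irreducible.  GIVEN (I′), (B6) is then EQUIVALENT to

  (M1θ) «every topologically irreducible closed invariant `W ⊆ L²([U(H)])` unitarily equivalent to `Q` IS `Q`»

— multiplicity one of the unitary class of the theta representation `Q = Θ(a, ξ)` in `L²([U(H)])` (★ `ContRepresentation.HasMultiplicityOne` restricted to the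
class of `Q`).  This file proves the implication (M1θ) ⟹ (B6) (§2, `thetaLiftFromLineRealises_of_irreducible_of_multiplicityOne`; corollary from the blanket
`HasMultiplicityOne` of the right regular representation, `thetaLiftFromLineRealises_of_irreducible_of_hasMultiplicityOne`) from the unitary Schur dichotomy of the
tree (★ `ContRepresentation.ClosedSubrep.isOrtho_of_not_areUnitarilyEquivalent`, [DeitmarEchterhoff2014, Cor. 6.1.9]): a discrete `P` with `pr_P v ≠ 0` for some
`v ∈ Q` is not orthogonal to `Q`, hence unitarily equivalent to the irreducible `Q`, hence `= Q` by (M1θ).  The converse (B6) ∧ (I′) ⟹ (M1θ) holds as well (an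
irreducible `W ≃ Q`, `W ≠ Q`, is either non-orthogonal to `Q` — then some generator `v` has `pr_W v ≠ 0` and (B6) forces `W ⊆ Q`, so `W = Q` — or orthogonal,
and then the isoclinic copy `{(q + u q)/√2}` (`u : Q ≃ W` isometric intertwiner) is a discrete `P ⊄ Q` with `pr_P v ≠ 0`, refuting (B6)); it is recorded here in
prose only.  CONSEQUENCE FOR THE BOOKS (census, not a booking): the printed road of (B6) is [Wu2013, Thm. 5.1] (Rallis inner product formula in reproducing form
⟸ doubling [PiatetskiShapiroRallis1987] + regularised Siegel–Weil [Ichino2004] on the doubled `U(N,N)` — NO carrier in the tree); the alternative road is §2 below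
(★, this file) + ONE printed multiplicity-one row for the θ-classes of the anisotropic `U(2)` ([Rogawski1990, §11.1–11.2, Thm. 11.5.1] `ρ(θ)`-packets with
the [LabesseLanglands1979] multiplicity formula `m ∈ {0, 1}`; inner forms via [Harris1993]) — the shape of the letter `Rogawski1990.curveMultiplicityLeOne`
RETIRED by the LEAD under PATH Y («LD-R3′», 2026-09-02T05:11:42Z) restricted to theta classes.  Either road is ONE printed row; this file changes no count.

* §1 `le_of_starProjection_ne_zero_of_multiplicityOne` — pure Hilbert space: for a unitary `π`, a closed invariant `Q` that is `0` or irreducible and has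
  multiplicity one in the above sense, and an irreducible closed invariant `W` with `pr_W v ≠ 0` for some `v ∈ Q`: `W ≤ Q` (indeed `W = Q`).
* §2 the (B6) glue over the letters' frame (rank-generic `N`, CM field `L`, scaled frame `formCongr c g (t • H) = diag dV`, pinned `ιA`).

References: [Liu2021] Y. Liu, Camb. J. Math. 9 (2021) = arXiv:2102.11518, App. B Cor. B.6 (1), (3) and their proofs (arXiv p. 45 L43–64).  [Wu2013] C. Wu,
J. Number Theory 133 (2013), Thm. 5.1.  [DeitmarEchterhoff2014] A. Deitmar, S. Echterhoff, *Principles of Harmonic Analysis*, 2nd ed. (2014), Cor. 6.1.9.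
[Dixmier1977] J. Dixmier, *C\*-algebras* (1977), §5.4.  [Rogawski1990] J. Rogawski, Ann. of Math. Stud. 123 (1990), §11.  [BorelJacquet1979] A. Borel,
H. Jacquet, PSPM 33.1 (1979), §4.6.
-/

set_option autoImplicit false
-- the mandated namespace has the single-problem summit's repeated segment (`HodgeConjecture.HodgeConjecture`)
set_option linter.dupNamespace false

noncomputable section

open NumberField MeasureTheory IsDedekindDomain
open scoped Matrix ComplexOrder ENNReal InnerProductSpace
open Literature.NumberTheory.Automorphic Literature.NumberTheory.Automorphic.UnitaryGroup
open Literature.NumberTheory.Automorphic.UnitaryGroup.CotangentForms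
open Literature.NumberTheory.Automorphic.IdeleClassGroup
open Literature.NumberTheory.Automorphic.Liu2021
open Literature.NumberTheory.Automorphic.Liu2021.Def411WeilCarriers
open Literature.NumberTheory.Automorphic.Liu2021.Def411WeilCarriersDoubling
open Literature.NumberTheory.GelbartRogawski1991 Literature.NumberTheory.GelbartRogawski1991.UnitaryDualPair
open Literature.NumberTheory.Weil1964
open Literature.RepresentationTheory.Liu2021
open Literature.RepresentationTheory.CompactGroups
open Literature.RepresentationTheory.HeisenbergGroup
open Summit.HodgeConjecture.HodgeConjecture.Cruxes.HLiu418.F0LD1CharThetaSpaceLeOfIrreducible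

namespace Summit.HodgeConjecture.HodgeConjecture.Cruxes.HLiu418.F0LD2ThetaRealisesOfMultiplicityOne

/-! ## §1 Unitary Schur dichotomy: an irreducible `W` seeing a vector of a multiplicity-one `Q` through `pr_W` IS `Q` -/

section Hilbert

variable {G E : Type*} [Group G] [NormedAddCommGroup E] [InnerProductSpace ℂ E] [CompleteSpace E]
  {π : ContRepresentation ℂ G E}

/-- **Schur dichotomy + multiplicity one.**  Let `π` be a unitary representation on a Hilbert space `E`, `Q` a closed invariant subspace which is `0` or
topologically irreducible and has MULTIPLICITY ONE in the sense «every irreducible closed invariant `W'` unitarily equivalent to `Q` equals `Q`», and `W` an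
irreducible closed invariant subspace such that the orthogonal projection `pr_W v` of some `v ∈ Q` is non-zero.  Then `W = Q`: `v ≠ 0` so `Q` is irreducible;
`W` and `Q` are not orthogonal (`pr_W v ≠ 0`, Mathlib `Submodule.starProjection_apply_eq_zero_iff`), so by the unitary Schur dichotomy (★
`ClosedSubrep.isOrtho_of_not_areUnitarilyEquivalent`) they are unitarily equivalent, and multiplicity one identifies them.
[cite: DeitmarEchterhoff2014, Cor. 6.1.9] [cite: Dixmier1977, §5.4] -/
theorem eq_of_starProjection_ne_zero_of_multiplicityOne (hπ : π.IsUnitary) {Q W : ContRepresentation.ClosedSubrep π}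
    (hQ : Q.toSubmodule = ⊥ ∨ Q.toContRep.IsTopIrreducible) (hW : W.toContRep.IsTopIrreducible)
    (hM1 : ∀ W' : ContRepresentation.ClosedSubrep π, W'.toContRep.IsTopIrreducible →
      ContRepresentation.AreUnitarilyEquivalent W'.toContRep Q.toContRep → W' = Q)
    {v : E} (hv : v ∈ Q.toSubmodule) (hne : W.toSubmodule.starProjection v ≠ 0) : W = Q := by
  -- `v ≠ 0`, so `Q ≠ 0` and `Q` is irreducible
  have hv0 : v ≠ 0 := by
    rintro rfl
    exact hne (map_zero _)
  have hQirr : Q.toContRep.IsTopIrreducible := by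
    rcases hQ with hbot | hirr
    · exact absurd ((Submodule.mem_bot ℂ).1 (hbot ▸ hv)) hv0
    · exact hirr
  -- `W` and `Q` are not orthogonal, hence unitarily equivalent
  have hWQ : ContRepresentation.AreUnitarilyEquivalent W.toContRep Q.toContRep := by
    by_contra hneq
    have horth : W.toSubmodule ⟂ Q.toSubmodule :=
      ContRepresentation.ClosedSubrep.isOrtho_of_not_areUnitarilyEquivalent hπ hW hQirr hneq
    have hvW : v ∈ W.toSubmoduleᗮ := horth.symm.le hv
    exact hne ((Submodule.starProjection_apply_eq_zero_iff _).2 hvW)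
  exact hM1 W hW hWQ

/-- Same, as an inclusion `W ≤ Q` (the form the realisation letter consumes). [cite: DeitmarEchterhoff2014, Cor. 6.1.9] -/
theorem le_of_starProjection_ne_zero_of_multiplicityOne (hπ : π.IsUnitary) {Q W : ContRepresentation.ClosedSubrep π}
    (hQ : Q.toSubmodule = ⊥ ∨ Q.toContRep.IsTopIrreducible) (hW : W.toContRep.IsTopIrreducible)
    (hM1 : ∀ W' : ContRepresentation.ClosedSubrep π, W'.toContRep.IsTopIrreducible →
      ContRepresentation.AreUnitarilyEquivalent W'.toContRep Q.toContRep → W' = Q)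
    {v : E} (hv : v ∈ Q.toSubmodule) (hne : W.toSubmodule.starProjection v ≠ 0) : W ≤ Q :=
  le_of_eq (eq_of_starProjection_ne_zero_of_multiplicityOne hπ hQ hW hM1 hv hne)

/-- With BLANKET multiplicity one (★ `ContRepresentation.HasMultiplicityOne π`: any two unitarily equivalent irreducible closed invariant subspaces
coincide) the multiplicity hypothesis at `Q` is automatic. [cite: Dixmier1977, §5.4] -/
theorem eq_of_starProjection_ne_zero_of_hasMultiplicityOne (hπ : π.IsUnitary) (hπ1 : π.HasMultiplicityOne)
    {Q W : ContRepresentation.ClosedSubrep π} (hQ : Q.toSubmodule = ⊥ ∨ Q.toContRep.IsTopIrreducible) (hW : W.toContRep.IsTopIrreducible)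
    {v : E} (hv : v ∈ Q.toSubmodule) (hne : W.toSubmodule.starProjection v ≠ 0) : W = Q := by
  have hv0 : v ≠ 0 := by
    rintro rfl
    exact hne (map_zero _)
  have hQirr : Q.toContRep.IsTopIrreducible := by
    rcases hQ with hbot | hirr
    · exact absurd ((Submodule.mem_bot ℂ).1 (hbot ▸ hv)) hv0
    · exact hirr
  exact eq_of_starProjection_ne_zero_of_multiplicityOne hπ hQ hW (fun W' hW' he => hπ1 W' Q hW' hQirr he) hv hne

end Hilbert

/-! ## §2 The realisation letter (B6) from (I′) and multiplicity one of the `(a, ξ)`-theta span -/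

section Realises

variable (L : Type) [Field L] [NumberField L] [IsCMField L] (N : ℕ) (H : Matrix (Fin N) (Fin N) L)
  {n' : ℕ} (e₁ : Fin N × Fin 1 ≃ Fin n') (dV : Fin N → L) (hdV : ∀ i, IsCMField.complexConj L (dV i) = dV i)
  (hdV0 : ∀ i, dV i ≠ 0) (t : L) (ht : t ≠ 0) (g : GL (Fin N) L)
  (hg : formCongr ((IsCMField.complexConj L : L ≃ₐ[(↥(maximalRealSubfield L))] L) : L →+* L) g (t • H) = Matrix.diagonal dV)
  (ιA : (adelicGroupData (↥(maximalRealSubfield L)) L (IsCMField.complexConj L) N H).Adelic →* ↥(UnitaryGroup.adelic (↥(maximalRealSubfield L)) L (IsCMField.complexConj L) N (Matrix.diagonal dV)))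
  (hιA : ∀ k, ((ιA k : ↥(UnitaryGroup.adelic (↥(maximalRealSubfield L)) L (IsCMField.complexConj L) N (Matrix.diagonal dV))) : GL (Fin N) (AdeleRing (𝓞 L) L)) =
    (toAdeleGL L g)⁻¹ * adelicVal (↥(maximalRealSubfield L)) L (IsCMField.complexConj L) N H k * toAdeleGL L g)
  [CompactSpace (↥(UnitaryGroup.adelic (↥(maximalRealSubfield L)) L (IsCMField.complexConj L) N (Matrix.diagonal dV)) ⧸ (UnitaryGroup.toAdelic (↥(maximalRealSubfield L)) L (IsCMField.complexConj L) N (Matrix.diagonal dV)).range)]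
  {μA : Measure (adelicGroupData (↥(maximalRealSubfield L)) L (IsCMField.complexConj L) N H).automorphicQuotient} [(adelicGroupData (↥(maximalRealSubfield L)) L (IsCMField.complexConj L) N H).IsAutomorphicMeasure μA] [CompactSpace (adelicGroupData (↥(maximalRealSubfield L)) L (IsCMField.complexConj L) N H).automorphicQuotient]

include ht hg hιA in
/-- **(B6) ⟸ (I′) + (M1θ).**  Under the letters' scaled frame `formCongr c g (t • H) = diag dV` with a pinned transport `ιA`, fix the splitting character `μ`,
the line `a` and the character `ξ` of `[U(⟨a⟩)]`.  IF the closed `(a, ξ)`-theta span is `0` or irreducible ((I′) ★ `ThetaLiftFromLineIrreducible`, Wu's first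
clause — in the tree a THEOREM over the CM curve frames) AND every discrete automorphic `P` unitarily equivalent to (a closed invariant subspace whose carrier
is) that closed span coincides with it ((M1θ) — multiplicity one of the theta representation `Θ(a, ξ)` in `L²([U(H)])`, the printed residue:
[Rogawski1990, §11] ∕ [Wu2013, Thm. 5.1]), THEN the realisation row (B6) `ThetaLiftFromLineRealises` holds: a discrete `P` with `pr_P v ≠ 0` for an
`(a, ξ)`-theta class `v` lies inside the closed theta span.  Proof: §1 with `W := P.space` and the span `Q` of ★ `exists_closedSubrep_thetaSpan`.
[cite: Liu2021, App. B Cor. B.6 (1), (3) and their proofs (p. 99)] [cite: Wu2013, Thm. 5.1] [cite: DeitmarEchterhoff2014, Cor. 6.1.9] [cite: Rogawski1990, §11.1] -/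
theorem thetaLiftFromLineRealises_of_irreducible_of_multiplicityOne
    (μ : Literature.NumberTheory.Automorphic.IdeleClassGroup L →ₜ* Circle) (hμ : IsConjugateSymplectic L μ) (a : (↥(maximalRealSubfield L))ˣ)
    (ξ : haveI := normal_range_toAdelic_JW L a
      PontryaginDual (↥(UnitaryGroup.adelic (↥(maximalRealSubfield L)) L (IsCMField.complexConj L) 1 (JW (↥(maximalRealSubfield L)) L a)) ⧸ (UnitaryGroup.toAdelic (↥(maximalRealSubfield L)) L (IsCMField.complexConj L) 1 (JW (↥(maximalRealSubfield L)) L a)).range))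
    (hIrr : ThetaLiftFromLineIrreducible L N H e₁ dV hdV hdV0 ιA μA μ hμ a ξ)
    (hM1 : letI : MeasurableSpace (↥(UnitaryGroup.adelic (↥(maximalRealSubfield L)) L (IsCMField.complexConj L) 1 (JW (↥(maximalRealSubfield L)) L a)) ⧸ (UnitaryGroup.toAdelic (↥(maximalRealSubfield L)) L (IsCMField.complexConj L) 1 (JW (↥(maximalRealSubfield L)) L a)).range) := borel _
      haveI := normal_range_toAdelic_JW L a
      ∀ (Q : ContRepresentation.ClosedSubrep ((adelicGroupData (↥(maximalRealSubfield L)) L (IsCMField.complexConj L) N H).rightRegular μA)),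
        (Q.toSubmodule : Set ((adelicGroupData (↥(maximalRealSubfield L)) L (IsCMField.complexConj L) N H).L2 μA)) = closure (Submodule.span ℂ
          {v : (adelicGroupData (↥(maximalRealSubfield L)) L (IsCMField.complexConj L) N H).L2 μA | ∃ (hρ : HasThetaMajorants fun
        (p : ↥(UnitaryGroup.adelic (↥(maximalRealSubfield L)) L (IsCMField.complexConj L) N (Matrix.diagonal dV)) × ↥(UnitaryGroup.adelic (↥(maximalRealSubfield L)) L (IsCMField.complexConj L) 1 (JW (↥(maximalRealSubfield L)) L a))) (Φ : piSchwartzBruhat (↥(maximalRealSubfield L)) (Fin n')) =>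
          pairRep (↥(maximalRealSubfield L)) L (IsCMField.complexConj L) N 1 e₁ (Matrix.diagonal dV) (JW (↥(maximalRealSubfield L)) L a)
            (chiSplittingLine L e₁ dV hdV hdV0 (toHeckeCharacter L μ) (isUnitary_toHeckeCharacter L μ)
              ((isOscillatorChar_toHeckeCharacter_iff μ).mpr hμ) (TW (↥(maximalRealSubfield L)) a)
              (isUnit_det_TW (↥(maximalRealSubfield L)) a) (JW (↥(maximalRealSubfield L)) L a) (JW_eq (↥(maximalRealSubfield L)) L a))
            p Φ)
          (μW : Measure (↥(UnitaryGroup.adelic (↥(maximalRealSubfield L)) L (IsCMField.complexConj L) 1 (JW (↥(maximalRealSubfield L)) L a)) ⧸ (UnitaryGroup.toAdelic (↥(maximalRealSubfield L)) L (IsCMField.complexConj L) 1 (JW (↥(maximalRealSubfield L)) L a)).range)) (_ : IsFiniteMeasure μW)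
          (_ : SMulInvariantMeasure ↥(UnitaryGroup.adelic (↥(maximalRealSubfield L)) L (IsCMField.complexConj L) 1 (JW (↥(maximalRealSubfield L)) L a)) (↥(UnitaryGroup.adelic (↥(maximalRealSubfield L)) L (IsCMField.complexConj L) 1 (JW (↥(maximalRealSubfield L)) L a)) ⧸ (UnitaryGroup.toAdelic (↥(maximalRealSubfield L)) L (IsCMField.complexConj L) 1 (JW (↥(maximalRealSubfield L)) L a)).range) μW)
          (Ψ : piSchwartzBruhat (↥(maximalRealSubfield L)) (Fin n'))
          (hθ : MemLp (toQuotFun (adelicGroupData (↥(maximalRealSubfield L)) L (IsCMField.complexConj L) N H) fun x =>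
            (lineThetaKernelDatum L N e₁ dV hdV hdV0 μ hμ a hρ).thetaLiftFun μW Ψ (charCM ξ) (ιA x)) 2 μA),
          v = MemLp.toLp _ hθ} : Set ((adelicGroupData (↥(maximalRealSubfield L)) L (IsCMField.complexConj L) N H).L2 μA)) →
        ∀ P : DiscreteAutomorphicRep (adelicGroupData (↥(maximalRealSubfield L)) L (IsCMField.complexConj L) N H) μA,
          ContRepresentation.AreUnitarilyEquivalent P.space.toContRep Q.toContRep → P.space = Q) :
    ThetaLiftFromLineRealises L N H e₁ dV hdV hdV0 ιA μA μ hμ a ξ := by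
  letI : MeasurableSpace (↥(UnitaryGroup.adelic (↥(maximalRealSubfield L)) L (IsCMField.complexConj L) 1 (JW (↥(maximalRealSubfield L)) L a)) ⧸
      (UnitaryGroup.toAdelic (↥(maximalRealSubfield L)) L (IsCMField.complexConj L) 1 (JW (↥(maximalRealSubfield L)) L a)).range) := borel _
  haveI := normal_range_toAdelic_JW L a
  intro P hP
  obtain ⟨hρ, μW, hfinW, hinvW, Ψ, hθ, hne⟩ := hP
  -- the `(a, ξ)`-theta span `Q`: closed, invariant, containing every `(a, ξ)`-theta class, with carrier the closure of their span
  obtain ⟨Q, hQmem, hQcar⟩ := exists_closedSubrep_thetaSpan L N H e₁ dV hdV hdV0 t ht g hg ιA hιA (μA := μA) μ hμ a ξ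
  have hvQ : MemLp.toLp _ hθ ∈ Q.toSubmodule := hQmem hρ μW hfinW hinvW Ψ hθ
  -- (I′): `Q = 0` or irreducible; §1: `P.space = Q`
  have hQ : Q.toSubmodule = ⊥ ∨ Q.toContRep.IsTopIrreducible := hIrr Q hQcar
  have hle : P.space ≤ Q :=
    le_of_starProjection_ne_zero_of_multiplicityOne
      ((adelicGroupData (↥(maximalRealSubfield L)) L (IsCMField.complexConj L) N H).isUnitary_rightRegular μA)
      hQ P.irreducible (fun W' hW' he => by
        -- an irreducible closed invariant `W'` is a discrete automorphic representation
        have h := hM1 Q hQcar ⟨W', hW'⟩ he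
        exact h) hvQ hne
  -- conclusion: `P ⊆ Q = closure (span S)`
  rw [← hQcar]
  exact fun w hw => hle hw

include ht hg hιA in
/-- **(B6) ⟸ (I′) + blanket multiplicity one of `L²([U(H)])`** (★ `ContRepresentation.HasMultiplicityOne` of the right regular representation — the shape of
the retired letter `Rogawski1990.curveMultiplicityLeOne`, [Rogawski1990, §11; LabesseLanglands1979; Harris1993]): the special case of
`thetaLiftFromLineRealises_of_irreducible_of_multiplicityOne` in which the multiplicity hypothesis is not restricted to the theta class.
[cite: Liu2021, App. B Cor. B.6 (1), (3) (p. 99)] [cite: Rogawski1990, §11.1] [cite: DeitmarEchterhoff2014, Cor. 6.1.9] -/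
theorem thetaLiftFromLineRealises_of_irreducible_of_hasMultiplicityOne
    (μ : Literature.NumberTheory.Automorphic.IdeleClassGroup L →ₜ* Circle) (hμ : IsConjugateSymplectic L μ) (a : (↥(maximalRealSubfield L))ˣ)
    (ξ : haveI := normal_range_toAdelic_JW L a
      PontryaginDual (↥(UnitaryGroup.adelic (↥(maximalRealSubfield L)) L (IsCMField.complexConj L) 1 (JW (↥(maximalRealSubfield L)) L a)) ⧸ (UnitaryGroup.toAdelic (↥(maximalRealSubfield L)) L (IsCMField.complexConj L) 1 (JW (↥(maximalRealSubfield L)) L a)).range))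
    (hIrr : ThetaLiftFromLineIrreducible L N H e₁ dV hdV hdV0 ιA μA μ hμ a ξ)
    (hM1 : ((adelicGroupData (↥(maximalRealSubfield L)) L (IsCMField.complexConj L) N H).rightRegular μA).HasMultiplicityOne) :
    ThetaLiftFromLineRealises L N H e₁ dV hdV hdV0 ιA μA μ hμ a ξ := by
  letI : MeasurableSpace (↥(UnitaryGroup.adelic (↥(maximalRealSubfield L)) L (IsCMField.complexConj L) 1 (JW (↥(maximalRealSubfield L)) L a)) ⧸
      (UnitaryGroup.toAdelic (↥(maximalRealSubfield L)) L (IsCMField.complexConj L) 1 (JW (↥(maximalRealSubfield L)) L a)).range) := borel _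
  haveI := normal_range_toAdelic_JW L a
  intro P hP
  obtain ⟨hρ, μW, hfinW, hinvW, Ψ, hθ, hne⟩ := hP
  obtain ⟨Q, hQmem, hQcar⟩ := exists_closedSubrep_thetaSpan L N H e₁ dV hdV hdV0 t ht g hg ιA hιA (μA := μA) μ hμ a ξ
  have hvQ : MemLp.toLp _ hθ ∈ Q.toSubmodule := hQmem hρ μW hfinW hinvW Ψ hθ
  have hQ : Q.toSubmodule = ⊥ ∨ Q.toContRep.IsTopIrreducible := hIrr Q hQcar
  have hPQ : P.space = Q :=
    eq_of_starProjection_ne_zero_of_hasMultiplicityOne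
      ((adelicGroupData (↥(maximalRealSubfield L)) L (IsCMField.complexConj L) N H).isUnitary_rightRegular μA) hM1 hQ P.irreducible hvQ hne
  rw [← hQcar, ← hPQ]

end Realises

end Summit.HodgeConjecture.HodgeConjecture.Cruxes.HLiu418.F0LD2ThetaRealisesOfMultiplicityOne

end
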